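import Mathlib
import Literature.Computability.AlgebraicComplexity.StandardFamilies
import Summits.ValiantsHypothesis.ValiantsHypothesis.Theorems.ChowBorderDepth3ChowBorderBoundPaddedFlattening

/-!
# `ChowBorderBound` in the small-padding regime `D⁴ ≤ n⁵`
# (the flattening rung of crux `ChowBorderDepth3.ChowBorderBound`, stmt-ValiantsHypothesis-5936)

Support file (`--supports stmt-ValiantsHypothesis-5936`) of route `ValiantsHypothesis/ChowBorderDepth3`.
The crux `ChowBorderBound` says: for every `c`, for all large `n` and ALL `r, D ≤ (n+2)^(c⌊√n⌋+c)`,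
the padded permanent has no border `σ_r(Ch_D)`-expression
`Σ_{i<r} Π_{j<D} ℓ_ij(ε) = ε^q per_n + ε^(q+1) G` (affine `ℓ_ij` over `ℂ[ε]`; Landsberg 2017,
Cor. 7.5.3.3).  From the padded flattening inequality `C(n,k)² ≤ r · C(D,k)`
(`PaddedFlattening.choose_sq_le_mul_choose_of_border`) this file proves the crux VERBATIM except
that the padding is restricted to `D⁴ ≤ n⁵` (`D ≤ n^(5/4)`; the top fan-in `r` keeps its full
quasi-polynomial range):

* `chowBorderBound_smallPadding` :
  `∀ c, ∃ n₀, ∀ n ≥ n₀, ∀ r D, r ≤ (n+2)^(c⌊√n⌋+c) → D⁴ ≤ n⁵ → ¬ ∃ q ℓ G, …`.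

More generally (`chowBorderBound_paddingBelowThreeHalves`) the same holds with `D^b ≤ n^a` for any
fixed `a, b` with `2a < 3b`, i.e. for every padding exponent below `3/2`.

Arithmetic: with `m = 2b+2`, `k = m(c⌊√n⌋+c) + 1` the inequality gives `(n+1-k)^(2k) ≤ r (kD)^k`
(`pow_le_of_choose_sq_le`: `k!·C(n,k) ≥ (n+1-k)^k`, `k!·C(D,k) ≤ D^k`, `k! ≤ k^k`); in the regime
`(kD)^m (n+2) ≤ (n+1-k)^(2m)` (`regime`, valid for `n ≥ 2^(2mb) (2mc+1)^(mb)` when `D^b ≤ n^a`,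
`2a < 3b`) this forces `(n+2)^k ≤ (n+2)^(m(c⌊√n⌋+c))`, i.e. `k ≤ m(c⌊√n⌋+c)` (`le_of_pow_le`) —
contradiction.  Also recorded: `n ≤ D`, `1 ≤ r`, `n² ≤ r·D` for every border expression.

Reach of the method (for planners).  Padding exponents `< 3/2` and nothing beyond: heuristically
`max_k C(n,k)²/C(D,k) ≈ exp(e n²/D) ≤ (n+2)^√n` once `D ≳ n^(3/2)`, and PROVABLY (§3,
`flatteningBound_consistent_in_chasm`) every flattening inequality already holds at `r = 1`,
`D = n²` (`C(n,k)² ≤ C(n²,k)`), a point of the chasm range for every `c ≥ 2` — the barrier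
`Literature.Barriers.ValiantsHypothesis.PartialDerivativesDetPerm` ("padding defeats flattenings")
as a theorem about this crux.  The open part of `ChowBorderBound` is the padding range
`n^(3/2) ≲ D ≤ (n+2)^(c⌊√n⌋+c)` (with `r ≥ 3`, by the landed rung `r ≤ 2`).

References: N. Nisan, A. Wigderson, Comput. Complexity 6 (1996/97) §3; J. M. Landsberg,
*Geometry and complexity theory*, CUP 2017, §6.2, §7.2, Cor. 7.5.3.3.
-/

-- `Summit.ValiantsHypothesis.ValiantsHypothesis.…` is the tree's mandated single-conjunct layout
-- (Sub = Summit), so the duplicated namespace component is intended.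
set_option linter.dupNamespace false

namespace Summit.ValiantsHypothesis.ValiantsHypothesis.Theorems.ChowBorderBound.PaddedFlatteningRung

open MvPolynomial Literature.Computability.AlgebraicComplexity
open Summit.ValiantsHypothesis.ValiantsHypothesis.Theorems.ChowBorderBound.PaddedFlattening
open scoped Polynomial

/-! ## §1 Arithmetic -/

/-- From `C(n,k)² ≤ r·C(D,k)` to `(n+1-k)^(2k) ≤ r·(kD)^k`, via `k!·C(n,k) = n(n-1)⋯(n-k+1) ≥
(n+1-k)^k`, `k!·C(D,k) ≤ D^k` and `k! ≤ k^k`. [folklore] -/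
theorem pow_le_of_choose_sq_le {n k r D : ℕ} (h : (n.choose k) ^ 2 ≤ r * D.choose k) :
    (n + 1 - k) ^ (2 * k) ≤ r * (k * D) ^ k := by
  have h1 : (n + 1 - k) ^ k ≤ k.factorial * n.choose k := by
    rw [← Nat.descFactorial_eq_factorial_mul_choose]
    exact Nat.pow_sub_le_descFactorial n k
  have h2 : k.factorial * D.choose k ≤ D ^ k := by
    rw [← Nat.descFactorial_eq_factorial_mul_choose]
    exact Nat.descFactorial_le_pow D k
  have h3 : k.factorial ≤ k ^ k := Nat.factorial_le_pow k
  calc (n + 1 - k) ^ (2 * k) = ((n + 1 - k) ^ k) ^ 2 := by rw [pow_mul']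
    _ ≤ (k.factorial * n.choose k) ^ 2 := Nat.pow_le_pow_left h1 2
    _ = k.factorial * (k.factorial * (n.choose k) ^ 2) := by ring
    _ ≤ k ^ k * (k.factorial * (r * D.choose k)) :=
        Nat.mul_le_mul h3 (Nat.mul_le_mul_left _ h)
    _ = r * (k ^ k * (k.factorial * D.choose k)) := by ring
    _ ≤ r * (k ^ k * D ^ k) := Nat.mul_le_mul_left _ (Nat.mul_le_mul_left _ h2)
    _ = r * (k * D) ^ k := by rw [mul_pow]

/-- Exponent extraction: in the regime `(kD)^m (n+2) ≤ (n+1-k)^(2m)`, the inequality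
`(n+1-k)^(2k) ≤ r (kD)^k` with `r ≤ (n+2)^E` forces `k ≤ mE` (raise to the `m`-th power, multiply
by `(n+2)^k`, cancel `(n+1-k)^(2mk)`). [folklore] -/
theorem le_of_pow_le {n E k r D m : ℕ} (hr : r ≤ (n + 2) ^ E)
    (hreg : (k * D) ^ m * (n + 2) ≤ (n + 1 - k) ^ (2 * m)) (hkn : k ≤ n)
    (h : (n + 1 - k) ^ (2 * k) ≤ r * (k * D) ^ k) : k ≤ m * E := by
  set a := n + 1 - k with ha
  set b := k * D with hb
  have ha1 : 1 ≤ a := by omega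
  have h8 : a ^ (2 * m * k) ≤ (n + 2) ^ (m * E) * b ^ (m * k) := by
    calc a ^ (2 * m * k) = (a ^ (2 * k)) ^ m := by rw [← pow_mul]; ring_nf
      _ ≤ (r * b ^ k) ^ m := Nat.pow_le_pow_left h m
      _ = r ^ m * b ^ (m * k) := by rw [mul_pow, ← pow_mul]; ring_nf
      _ ≤ ((n + 2) ^ E) ^ m * b ^ (m * k) := Nat.mul_le_mul_right _ (Nat.pow_le_pow_left hr m)
      _ = (n + 2) ^ (m * E) * b ^ (m * k) := by rw [← pow_mul]; ring_nf
  have e1 : (b ^ m * (n + 2)) ^ k = b ^ (m * k) * (n + 2) ^ k := by rw [mul_pow, ← pow_mul]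
  have hkey : a ^ (2 * m * k) * (n + 2) ^ k ≤ a ^ (2 * m * k) * (n + 2) ^ (m * E) := by
    calc a ^ (2 * m * k) * (n + 2) ^ k ≤ (n + 2) ^ (m * E) * b ^ (m * k) * (n + 2) ^ k :=
          Nat.mul_le_mul_right _ h8
      _ = (n + 2) ^ (m * E) * (b ^ m * (n + 2)) ^ k := by rw [e1, mul_assoc]
      _ ≤ (n + 2) ^ (m * E) * (a ^ (2 * m)) ^ k :=
          Nat.mul_le_mul_left _ (Nat.pow_le_pow_left hreg k)
      _ = a ^ (2 * m * k) * (n + 2) ^ (m * E) := by rw [← pow_mul, mul_comm]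
  have hpos : 0 < a ^ (2 * m * k) := pow_pos ha1 _
  have hle : (n + 2) ^ k ≤ (n + 2) ^ (m * E) := Nat.le_of_mul_le_mul_left hkey hpos
  exact (Nat.pow_le_pow_iff_right (by omega)).1 hle

/-- **The regime** for a padding exponent `a/b < 3/2`: with `m = 2b+2`, `M = 2mc+1`,
`k = m(c⌊√n⌋+c)+1`, for `n ≥ 2^(2mb) M^(mb)` and `D^b ≤ n^a` one has `k ≤ n` and
`(kD)^m (n+2) ≤ (n+1-k)^(2m)` (since `k ≤ M⌊√n⌋ ≤ n/2`, `k^(mb) ≤ M^(mb) n^((b+1)b)`,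
`D^(mb) ≤ n^(am)` and `(b+1)b + am + b + 1 ≤ 2mb`, which is where `2a < 3b` enters). [folklore] -/
theorem regime {a b c n D : ℕ} (hab : 2 * a < 3 * b)
    (hn : 2 ^ (2 * (2 * b + 2) * b) * (2 * (2 * b + 2) * c + 1) ^ ((2 * b + 2) * b) ≤ n)
    (hD : D ^ b ≤ n ^ a) :
    (2 * b + 2) * (c * Nat.sqrt n + c) + 1 ≤ n ∧
      (((2 * b + 2) * (c * Nat.sqrt n + c) + 1) * D) ^ (2 * b + 2) * (n + 2) ≤
        (n + 1 - ((2 * b + 2) * (c * Nat.sqrt n + c) + 1)) ^ (2 * (2 * b + 2)) := by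
  have hb : 1 ≤ b := by omega
  set s := Nat.sqrt n with hs_def
  set m := 2 * b + 2 with hm_def
  set k := m * (c * s + c) + 1 with hk_def
  set M := 2 * m * c + 1 with hM_def
  have hM1 : 1 ≤ M := by omega
  have hmb : 2 ≤ m * b := by nlinarith
  -- `n ≥ 4 M²`, so `s ≥ 2M`
  have hbig : 4 * M ^ 2 ≤ 2 ^ (2 * m * b) * M ^ (m * b) := by
    have h4 : 4 ≤ 2 ^ (2 * m * b) := by
      calc (4 : ℕ) = 2 ^ 2 := by norm_num
        _ ≤ 2 ^ (2 * m * b) := Nat.pow_le_pow_right (by norm_num) (by nlinarith)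
    exact Nat.mul_le_mul h4 (Nat.pow_le_pow_right hM1 hmb)
  have hs : 2 * M ≤ s := by
    rw [hs_def, Nat.le_sqrt]
    calc 2 * M * (2 * M) = 4 * M ^ 2 := by ring
      _ ≤ _ := hbig
      _ ≤ n := hn
  have hs1 : 1 ≤ s := le_trans (by omega) hs
  have hss : s * s ≤ n := Nat.sqrt_le n
  have hkM : k ≤ M * s := by
    have : c ≤ c * s := Nat.le_mul_of_pos_right c hs1
    rw [hk_def, hM_def]; nlinarith
  have h2k : 2 * k ≤ n := by
    calc 2 * k ≤ 2 * (M * s) := Nat.mul_le_mul_left _ hkM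
      _ = (2 * M) * s := by ring
      _ ≤ s * s := Nat.mul_le_mul_right _ hs
      _ ≤ n := hss
  refine ⟨by omega, ?_⟩
  have hA : n + 2 ≤ 2 * (n + 1 - k) := by omega
  -- compare `b`-th powers
  have hb0 : b ≠ 0 := by omega
  rw [← Nat.pow_le_pow_iff_left hb0]
  -- exponent bookkeeping: X + 1 ≤ 2 m b where X = (b+1) b + a m + b
  have hexp : (b + 1) * b + a * m + b + 1 ≤ 2 * m * b := by
    have := Nat.mul_le_mul_right (b + 1) (Nat.succ_le_of_lt hab)
    rw [hm_def]; nlinarith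
  have hkpow : k ^ (m * b) ≤ M ^ (m * b) * n ^ ((b + 1) * b) := by
    calc k ^ (m * b) ≤ (M * s) ^ (m * b) := Nat.pow_le_pow_left hkM _
      _ = M ^ (m * b) * (s * s) ^ ((b + 1) * b) := by
          rw [mul_pow, hm_def, ← pow_two, ← pow_mul]; ring_nf
      _ ≤ M ^ (m * b) * n ^ ((b + 1) * b) := Nat.mul_le_mul_left _ (Nat.pow_le_pow_left hss _)
  have hDpow : D ^ (m * b) ≤ n ^ (a * m) := by
    calc D ^ (m * b) = (D ^ b) ^ m := by rw [← pow_mul, mul_comm]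
      _ ≤ (n ^ a) ^ m := Nat.pow_le_pow_left hD m
      _ = n ^ (a * m) := by rw [← pow_mul]
  have hn2 : n ≤ n + 2 := by omega
  have hmain : 2 ^ (2 * m * b) * ((k * D) ^ m * (n + 2)) ^ b ≤
      2 ^ (2 * m * b) * ((n + 1 - k) ^ (2 * m)) ^ b := by
    calc 2 ^ (2 * m * b) * ((k * D) ^ m * (n + 2)) ^ b
          = 2 ^ (2 * m * b) * (k ^ (m * b) * D ^ (m * b) * (n + 2) ^ b) := by
          rw [mul_pow, ← pow_mul, mul_pow]
      _ ≤ 2 ^ (2 * m * b) * (M ^ (m * b) * n ^ ((b + 1) * b) * n ^ (a * m) * (n + 2) ^ b) :=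
          Nat.mul_le_mul_left _ (Nat.mul_le_mul_right _ (Nat.mul_le_mul hkpow hDpow))
      _ ≤ 2 ^ (2 * m * b) *
            (M ^ (m * b) * (n + 2) ^ ((b + 1) * b) * (n + 2) ^ (a * m) * (n + 2) ^ b) :=
          Nat.mul_le_mul_left _ (Nat.mul_le_mul_right _ (Nat.mul_le_mul (Nat.mul_le_mul_left _
            (Nat.pow_le_pow_left hn2 _)) (Nat.pow_le_pow_left hn2 _)))
      _ = (2 ^ (2 * m * b) * M ^ (m * b)) * (n + 2) ^ ((b + 1) * b + a * m + b) := by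
          rw [pow_add, pow_add]; ring
      _ ≤ (n + 2) * (n + 2) ^ ((b + 1) * b + a * m + b) :=
          Nat.mul_le_mul_right _ (hn.trans hn2)
      _ = (n + 2) ^ ((b + 1) * b + a * m + b + 1) := by rw [pow_succ]; ring
      _ ≤ (n + 2) ^ (2 * m * b) := Nat.pow_le_pow_right (by omega) hexp
      _ ≤ (2 * (n + 1 - k)) ^ (2 * m * b) := Nat.pow_le_pow_left hA _
      _ = 2 ^ (2 * m * b) * ((n + 1 - k) ^ (2 * m)) ^ b := by rw [mul_pow, ← pow_mul]
  exact Nat.le_of_mul_le_mul_left hmain (by positivity)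


/-! ## §2 The rung, and two small consequences of the flattening inequality -/

variable {n r D q : ℕ}

/-- `k = n`: a border `σ_r(Ch_D)`-expression of the padded permanent needs `n ≤ D` and `1 ≤ r`.
[cite: LandsbergGCT2017, §7.2] -/
theorem le_of_border
    (ℓ : Fin r → Fin D → MvPolynomial (Fin n × Fin n) ℂ[X])
    (G : MvPolynomial (Fin n × Fin n) ℂ[X]) (hℓ : ∀ i j, (ℓ i j).totalDegree ≤ 1)
    (hsum : ∑ i, ∏ j, ℓ i j =
      C (Polynomial.X ^ q) * MvPolynomial.map Polynomial.C (perPoly (Fin n) ℂ) +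
        C (Polynomial.X ^ (q + 1)) * G) :
    n ≤ D ∧ 1 ≤ r := by
  have h := choose_sq_le_mul_choose_of_border ℓ G hℓ hsum n le_rfl
  rw [Nat.choose_self, one_pow] at h
  have hne : r * D.choose n ≠ 0 := by omega
  rw [mul_ne_zero_iff] at hne
  exact ⟨not_lt.1 fun hlt => hne.2 (Nat.choose_eq_zero_of_lt hlt), Nat.one_le_iff_ne_zero.2 hne.1⟩

/-- `k = 1`: a border `σ_r(Ch_D)`-expression of the padded permanent needs `n² ≤ r · D`
(`n ≥ 1`). [cite: LandsbergGCT2017, §7.2] -/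
theorem sq_le_mul_of_border (hn : 1 ≤ n)
    (ℓ : Fin r → Fin D → MvPolynomial (Fin n × Fin n) ℂ[X])
    (G : MvPolynomial (Fin n × Fin n) ℂ[X]) (hℓ : ∀ i j, (ℓ i j).totalDegree ≤ 1)
    (hsum : ∑ i, ∏ j, ℓ i j =
      C (Polynomial.X ^ q) * MvPolynomial.map Polynomial.C (perPoly (Fin n) ℂ) +
        C (Polynomial.X ^ (q + 1)) * G) :
    n ^ 2 ≤ r * D := by
  have h := choose_sq_le_mul_choose_of_border ℓ G hℓ hsum 1 hn
  rwa [Nat.choose_one_right, Nat.choose_one_right] at h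

/-- **`ChowBorderBound` for every padding exponent below `3/2`** (registered sub-goal
`chowBorderBound_paddingBelowThreeHalves` of stmt-ValiantsHypothesis-5936): for all `a, b` with
`2a < 3b` and every `c`, for all large `n`, all `r ≤ (n+2)^(c⌊√n⌋+c)` and all `D` with
`D^b ≤ n^a`, the padded permanent has NO border `σ_r(Ch_D)`-expression — the crux verbatim with
the padding restricted to `D ≤ n^(a/b)`, `a/b < 3/2`.  Flattenings: `C(n,k)² ≤ r·C(D,k)` at
`k = (2b+2)(c⌊√n⌋+c)+1`. [cite: LandsbergGCT2017, §7.2] -/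
theorem chowBorderBound_paddingBelowThreeHalves :
    ∀ a b c : ℕ, 2 * a < 3 * b → ∃ n₀ : ℕ, ∀ n ≥ n₀, ∀ r D : ℕ,
      r ≤ (n + 2) ^ (c * Nat.sqrt n + c) → D ^ b ≤ n ^ a →
      ¬ ∃ (q : ℕ) (ℓ : Fin r → Fin D → MvPolynomial (Fin n × Fin n) (Polynomial ℂ))
          (G : MvPolynomial (Fin n × Fin n) (Polynomial ℂ)),
          (∀ i j, (ℓ i j).totalDegree ≤ 1) ∧
          (∑ i, ∏ j, ℓ i j) =
            MvPolynomial.C (Polynomial.X ^ q) *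
                MvPolynomial.map Polynomial.C
                  (Literature.Computability.AlgebraicComplexity.perPoly (Fin n) ℂ) +
              MvPolynomial.C (Polynomial.X ^ (q + 1)) * G := by
  intro a b c hab
  refine ⟨2 ^ (2 * (2 * b + 2) * b) * (2 * (2 * b + 2) * c + 1) ^ ((2 * b + 2) * b),
    fun n hn r D hr hD hex => ?_⟩
  obtain ⟨q, ℓ, G, hℓ, hsum⟩ := hex
  obtain ⟨hkn, hreg⟩ := regime (c := c) hab hn hD
  have hflat := choose_sq_le_mul_choose_of_border ℓ G hℓ hsum
    ((2 * b + 2) * (c * Nat.sqrt n + c) + 1) hkn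
  have hk := le_of_pow_le hr hreg hkn (pow_le_of_choose_sq_le hflat)
  omega

/-- **`ChowBorderBound` in the small-padding regime `D⁴ ≤ n⁵`** (registered sub-goal
`chowBorderBound_smallPadding` of stmt-ValiantsHypothesis-5936): the case `a/b = 5/4` of the
previous theorem — for every `c`, for all large `n`, all `r ≤ (n+2)^(c⌊√n⌋+c)` and all `D` with
`D⁴ ≤ n⁵`, the padded permanent has no border `σ_r(Ch_D)`-expression. [cite: LandsbergGCT2017, §7.2] -/
theorem chowBorderBound_smallPadding :
    ∀ c : ℕ, ∃ n₀ : ℕ, ∀ n ≥ n₀, ∀ r D : ℕ, r ≤ (n + 2) ^ (c * Nat.sqrt n + c) →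
      D ^ 4 ≤ n ^ 5 →
      ¬ ∃ (q : ℕ) (ℓ : Fin r → Fin D → MvPolynomial (Fin n × Fin n) (Polynomial ℂ))
          (G : MvPolynomial (Fin n × Fin n) (Polynomial ℂ)),
          (∀ i j, (ℓ i j).totalDegree ≤ 1) ∧
          (∑ i, ∏ j, ℓ i j) =
            MvPolynomial.C (Polynomial.X ^ q) *
                MvPolynomial.map Polynomial.C
                  (Literature.Computability.AlgebraicComplexity.perPoly (Fin n) ℂ) +
              MvPolynomial.C (Polynomial.X ^ (q + 1)) * G :=
  fun c => chowBorderBound_paddingBelowThreeHalves 5 4 c (by norm_num)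

/-! ## §3 Reach of the method: the flattening inequalities are consistent inside the chasm range -/

/-- `C(n,k)² ≤ C(n²,k)`: pairs of `k`-subsets of `[n]` inject into `k`-subsets of `[n]²` (zip the
two increasing enumerations). [folklore] -/
theorem choose_sq_le_choose_sq (n k : ℕ) : (n.choose k) ^ 2 ≤ (n ^ 2).choose k := by
  classical
  set P : Finset (Finset (Fin n)) := Finset.powersetCard k Finset.univ with hP
  set Q : Finset (Finset (Fin n × Fin n)) := Finset.powersetCard k Finset.univ with hQ
  have hPc : P.card = n.choose k := by
    rw [hP, Finset.card_powersetCard, Finset.card_univ, Fintype.card_fin]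
  have hQc : Q.card = (n ^ 2).choose k := by
    rw [hQ, Finset.card_powersetCard, Finset.card_univ, Fintype.card_prod, Fintype.card_fin, sq]
  -- the zip map
  let f : Finset (Fin n) × Finset (Fin n) → Finset (Fin n × Fin n) := fun p =>
    if h : p.1.card = k ∧ p.2.card = k then
      (Finset.univ : Finset (Fin k)).image
        (fun i => (p.1.orderEmbOfFin h.1 i, p.2.orderEmbOfFin h.2 i))
    else ∅
  have hmemP : ∀ {S : Finset (Fin n)}, S ∈ P → S.card = k := fun h =>
    (Finset.mem_powersetCard.1 h).2
  have hf_inj_fun : ∀ (S T : Finset (Fin n)) (hS : S.card = k) (hT : T.card = k),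
      Function.Injective (fun i : Fin k => (S.orderEmbOfFin hS i, T.orderEmbOfFin hT i)) :=
    fun S T hS hT i j hij => (S.orderEmbOfFin hS).injective (Prod.ext_iff.1 hij).1
  have hPP : ∀ {p : Finset (Fin n) × Finset (Fin n)}, p ∈ P ×ˢ P → p.1.card = k ∧ p.2.card = k :=
    fun hp => ⟨hmemP (Finset.mem_product.1 hp).1, hmemP (Finset.mem_product.1 hp).2⟩
  have hf_eval : ∀ (p : Finset (Fin n) × Finset (Fin n)) (h : p.1.card = k ∧ p.2.card = k),
      f p = (Finset.univ : Finset (Fin k)).image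
        (fun i => (p.1.orderEmbOfFin h.1 i, p.2.orderEmbOfFin h.2 i)) :=
    fun p h => dif_pos h
  -- first and second projections recover the pair
  have hfst : ∀ p ∈ P ×ˢ P, (f p).image Prod.fst = p.1 := by
    intro p hp
    rw [hf_eval p (hPP hp), Finset.image_image]
    apply Finset.coe_injective
    rw [Finset.coe_image, Finset.coe_univ, Set.image_univ]
    exact Finset.range_orderEmbOfFin _ _
  have hsnd : ∀ p ∈ P ×ˢ P, (f p).image Prod.snd = p.2 := by
    intro p hp
    rw [hf_eval p (hPP hp), Finset.image_image]
    apply Finset.coe_injective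
    rw [Finset.coe_image, Finset.coe_univ, Set.image_univ]
    exact Finset.range_orderEmbOfFin _ _
  have hmaps : ∀ p ∈ P ×ˢ P, f p ∈ Q := by
    intro p hp
    rw [hQ, Finset.mem_powersetCard]
    refine ⟨Finset.subset_univ _, ?_⟩
    rw [hf_eval p (hPP hp), Finset.card_image_of_injective _ (hf_inj_fun _ _ _ _), Finset.card_univ,
      Fintype.card_fin]
  have hinj : Set.InjOn f ↑(P ×ˢ P) := by
    intro p hp p' hp' hpp
    have h1 := hfst p hp
    have h2 := hsnd p hp
    rw [hpp] at h1 h2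
    rw [hfst p' hp'] at h1
    rw [hsnd p' hp'] at h2
    exact Prod.ext h1.symm h2.symm
  calc (n.choose k) ^ 2 = (P ×ˢ P).card := by rw [Finset.card_product, hPc, sq]
    _ ≤ Q.card := Finset.card_le_card_of_injOn f hmaps hinj
    _ = (n ^ 2).choose k := hQc


/-- **Barrier certificate for the method.**  The necessary condition `∀ k ≤ n, C(n,k)² ≤ r·C(D,k)`
extracted by flattenings (`chowBorderBound_flatteningBound`) is ALREADY met at `r = 1`, `D = n²`,
which lie in the chasm range `≤ (n+2)^(c⌊√n⌋+c)` for every `c ≥ 2` and every `n`: padding to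
degree `n²` saturates every flattening of `per_n` with a single product of affine forms.  Hence
no argument whose only input is the flattening inequality proves `ChowBorderBound` (at any
`c ≥ 2`) — the barrier `PartialDerivativesDetPerm` for this crux, as a theorem. [folklore] -/
theorem flatteningBound_consistent_in_chasm (c : ℕ) (hc : 2 ≤ c) (n : ℕ) :
    ∃ r D : ℕ, r ≤ (n + 2) ^ (c * Nat.sqrt n + c) ∧ D ≤ (n + 2) ^ (c * Nat.sqrt n + c) ∧
      ∀ k ≤ n, (n.choose k) ^ 2 ≤ r * D.choose k := by
  refine ⟨1, n ^ 2, Nat.one_le_pow _ _ (by omega), ?_, fun k _ => ?_⟩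
  · calc n ^ 2 ≤ (n + 2) ^ 2 := Nat.pow_le_pow_left (by omega) 2
      _ ≤ (n + 2) ^ (c * Nat.sqrt n + c) := Nat.pow_le_pow_right (by omega) (by nlinarith)
  · rw [one_mul]
    exact choose_sq_le_choose_sq n k

end Summit.ValiantsHypothesis.ValiantsHypothesis.Theorems.ChowBorderBound.PaddedFlatteningRung
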